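import Mathlib
import Summits.ValiantsHypothesis.ValiantsHypothesis.Theorems.NewtonUnitEquationsNewtonTauWeakCornerDefs

/-!
# `NewtonTauWeak` (stmt-ValiantsHypothesis-5904), stub `fixedKCoincidence_t2_K3`: Laurent polynomials,
# initial exponents for a generic weight, low-weight congruences

Support file (siege k16, polynomial-identity route) for the `K = 3` sub-stub of `stub_binomialNewtonTauCommon`.
Objects are INLINED (no definitions): the Laurent ring is `AddMonoidAlgebra ℂ (Fin 2 → ℤ)`, the weight is
`NewtonTauWeakCorner.wt`, and "`v` is the `w`-initial exponent of `F`" is the conjunction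
`F.coeff v ≠ 0 ∧ ∀ z, F.coeff z ≠ 0 → z ≠ v → wt w v < wt w z`.
Main results: uniqueness/existence of initial exponents, multiplicativity (`k16_isInit_mul`), initial exponent of a
monomial, of a sum dominated by one summand, transfer along low-weight congruences, and the product rule for
low-weight congruences of elements with nonnegative-weight support (`lowEq_mul`). [folklore]
-/

set_option linter.dupNamespace false

noncomputable section

open scoped BigOperators

namespace Summit.ValiantsHypothesis.ValiantsHypothesis.Theorems.NewtonTauWeakFixedK3k16

open Summit.ValiantsHypothesis.ValiantsHypothesis.Theorems.NewtonTauWeakCorner (wt wt_add wt_zero)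

/-! ## Initial exponents -/

/-- Uniqueness of the initial exponent. [folklore] -/
theorem isInit_unique {w : Fin 2 → ℝ} {F : AddMonoidAlgebra ℂ (Fin 2 → ℤ)} {v v' : Fin 2 → ℤ}
    (hv : F.coeff v ≠ 0 ∧ ∀ z, F.coeff z ≠ 0 → z ≠ v → wt w v < wt w z)
    (hv' : F.coeff v' ≠ 0 ∧ ∀ z, F.coeff z ≠ 0 → z ≠ v' → wt w v' < wt w z) : v = v' := by
  by_contra hne
  have h1 := hv.2 v' hv'.1 (Ne.symm hne)
  have h2 := hv'.2 v hv.1 hne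
  linarith

/-- Existence of the initial exponent of a nonzero Laurent polynomial for a generic weight. [folklore] -/
theorem exists_isInit {w : Fin 2 → ℝ} (hgen : Function.Injective (wt w))
    {F : AddMonoidAlgebra ℂ (Fin 2 → ℤ)} (hF : F ≠ 0) :
    ∃ v, F.coeff v ≠ 0 ∧ ∀ z, F.coeff z ≠ 0 → z ≠ v → wt w v < wt w z := by
  classical
  have hne : F.coeff.support.Nonempty := by
    rw [Finsupp.support_nonempty_iff]
    intro h
    apply hF
    ext z
    simp [h]
  obtain ⟨v, hv, hmin⟩ := F.coeff.support.exists_min_image (wt w) hne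
  refine ⟨v, Finsupp.mem_support_iff.mp hv, fun z hz hzv => ?_⟩
  have hle := hmin z (Finsupp.mem_support_iff.mpr hz)
  exact lt_of_le_of_ne hle fun h => hzv (hgen h).symm

/-- The weak form of minimality: every exponent of `F` weighs at least the initial one. [folklore] -/
theorem wt_le_of_isInit {w : Fin 2 → ℝ} {F : AddMonoidAlgebra ℂ (Fin 2 → ℤ)} {v : Fin 2 → ℤ}
    (hv : F.coeff v ≠ 0 ∧ ∀ z, F.coeff z ≠ 0 → z ≠ v → wt w v < wt w z)
    {z : Fin 2 → ℤ} (hz : F.coeff z ≠ 0) : wt w v ≤ wt w z := by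
  by_cases h : z = v
  · rw [h]
  · exact (hv.2 z hz h).le

/-- The initial exponent of a monomial. [folklore] -/
theorem isInit_single (w : Fin 2 → ℝ) (z : Fin 2 → ℤ) {c : ℂ} (hc : c ≠ 0) :
    (AddMonoidAlgebra.single z c).coeff z ≠ 0 ∧
      ∀ z', (AddMonoidAlgebra.single z c).coeff z' ≠ 0 → z' ≠ z → wt w z < wt w z' := by
  refine ⟨by simpa [AddMonoidAlgebra.coeff_single] using hc, fun z' hz' hne => ?_⟩
  exfalso
  apply hz'
  simp [AddMonoidAlgebra.coeff_single, Ne.symm hne]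

/-- Exponents of a product are sums of exponents of the factors. [folklore] -/
theorem exists_add_of_coeff_mul_ne_zero {F G : AddMonoidAlgebra ℂ (Fin 2 → ℤ)} {z : Fin 2 → ℤ}
    (hz : (F * G).coeff z ≠ 0) : ∃ x y, F.coeff x ≠ 0 ∧ G.coeff y ≠ 0 ∧ x + y = z := by
  classical
  have hmem : z ∈ (F * G).coeff.support := Finsupp.mem_support_iff.mpr hz
  have := AddMonoidAlgebra.support_coeff_mul_subset F G hmem
  obtain ⟨x, hx, y, hy, hxy⟩ := Finset.mem_add.mp this
  exact ⟨x, y, Finsupp.mem_support_iff.mp hx, Finsupp.mem_support_iff.mp hy, hxy⟩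

/-- The coefficient of a product as a double sum over the supports. [folklore] -/
theorem coeff_mul_eq_sum (F G : AddMonoidAlgebra ℂ (Fin 2 → ℤ)) (z : Fin 2 → ℤ) :
    (F * G).coeff z = ∑ x ∈ F.coeff.support, ∑ y ∈ G.coeff.support,
      if x + y = z then F.coeff x * G.coeff y else 0 := by
  classical
  rw [AddMonoidAlgebra.coeff_mul]
  simp only [Finsupp.sum]

/-- **Multiplicativity of initial exponents** (generic weight; `ℂ` has no zero divisors). [folklore] -/
theorem k16_isInit_mul {w : Fin 2 → ℝ} (hgen : Function.Injective (wt w))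
    {F G : AddMonoidAlgebra ℂ (Fin 2 → ℤ)} {a b : Fin 2 → ℤ}
    (ha : F.coeff a ≠ 0 ∧ ∀ z, F.coeff z ≠ 0 → z ≠ a → wt w a < wt w z)
    (hb : G.coeff b ≠ 0 ∧ ∀ z, G.coeff z ≠ 0 → z ≠ b → wt w b < wt w z) :
    (F * G).coeff (a + b) ≠ 0 ∧ ∀ z, (F * G).coeff z ≠ 0 → z ≠ a + b → wt w (a + b) < wt w z := by
  classical
  -- a pair of exponents summing to `a + b` is `(a, b)`
  have hpair : ∀ x y, F.coeff x ≠ 0 → G.coeff y ≠ 0 → x + y = a + b → x = a ∧ y = b := by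
    intro x y hx hy hxy
    have h1 := wt_le_of_isInit ha hx
    have h2 := wt_le_of_isInit hb hy
    have h3 : wt w x + wt w y = wt w a + wt w b := by rw [← wt_add, ← wt_add, hxy]
    have hxa : wt w x = wt w a := by linarith
    have hx' : x = a := hgen hxa
    refine ⟨hx', ?_⟩
    subst hx'
    exact add_left_cancel hxy
  constructor
  · rw [coeff_mul_eq_sum]
    rw [Finset.sum_eq_single a, Finset.sum_eq_single b]
    · simpa using mul_ne_zero ha.1 hb.1
    · intro y hy hyb
      rw [if_neg]
      intro h
      exact hyb (hpair a y ha.1 (Finsupp.mem_support_iff.mp hy) h).2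
    · intro h; exact absurd (Finsupp.mem_support_iff.mpr hb.1) h
    · intro x hx hxa
      refine Finset.sum_eq_zero fun y hy => ?_
      rw [if_neg]
      intro h
      exact hxa (hpair x y (Finsupp.mem_support_iff.mp hx) (Finsupp.mem_support_iff.mp hy) h).1
    · intro h; exact absurd (Finsupp.mem_support_iff.mpr ha.1) h
  · intro z hz hne
    obtain ⟨x, y, hx, hy, rfl⟩ := exists_add_of_coeff_mul_ne_zero hz
    have h1 := wt_le_of_isInit ha hx
    have h2 := wt_le_of_isInit hb hy
    rw [wt_add, wt_add]
    rcases lt_or_eq_of_le h1 with h1 | h1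
    · linarith
    · have hxa : x = a := hgen h1.symm
      subst hxa
      rcases lt_or_eq_of_le h2 with h2 | h2
      · linarith
      · exact absurd (congrArg (x + ·) (hgen h2.symm)) hne

/-- Scaling by a nonzero constant keeps the initial exponent. [folklore] -/
theorem isInit_smul {w : Fin 2 → ℝ} {F : AddMonoidAlgebra ℂ (Fin 2 → ℤ)} {v : Fin 2 → ℤ} {c : ℂ} (hc : c ≠ 0)
    (hv : F.coeff v ≠ 0 ∧ ∀ z, F.coeff z ≠ 0 → z ≠ v → wt w v < wt w z) :
    (c • F).coeff v ≠ 0 ∧ ∀ z, (c • F).coeff z ≠ 0 → z ≠ v → wt w v < wt w z := by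
  refine ⟨?_, fun z hz hne => hv.2 z ?_ hne⟩
  · simpa [AddMonoidAlgebra.coeff_smul] using ⟨hc, hv.1⟩
  · simp only [AddMonoidAlgebra.coeff_smul, Finsupp.coe_smul, Pi.smul_apply, smul_eq_mul] at hz
    exact right_ne_zero_of_mul hz

/-- A sum whose second summand lies strictly above the initial exponent of the first. [folklore] -/
theorem isInit_add_of_lt {w : Fin 2 → ℝ} {F G : AddMonoidAlgebra ℂ (Fin 2 → ℤ)} {v : Fin 2 → ℤ}
    (hv : F.coeff v ≠ 0 ∧ ∀ z, F.coeff z ≠ 0 → z ≠ v → wt w v < wt w z)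
    (hG : ∀ z, G.coeff z ≠ 0 → wt w v < wt w z) :
    (F + G).coeff v ≠ 0 ∧ ∀ z, (F + G).coeff z ≠ 0 → z ≠ v → wt w v < wt w z := by
  have hGv : G.coeff v = 0 := by
    by_contra h
    exact lt_irrefl _ (hG v h)
  refine ⟨?_, fun z hz hne => ?_⟩
  · simp [AddMonoidAlgebra.coeff_add, hGv, hv.1]
  · simp only [AddMonoidAlgebra.coeff_add, Finsupp.coe_add, Pi.add_apply] at hz
    by_cases hF : F.coeff z = 0
    · rw [hF, zero_add] at hz
      exact hG z hz
    · exact hv.2 z hF hne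

/-- Transfer of the initial exponent along agreement of all coefficients of weight `≤ wt v`… in the weak
form needed: `F` and `F'` agree at every exponent of weight `< β`, and `wt v < β`. [folklore] -/
theorem isInit_of_lowEq {w : Fin 2 → ℝ} {F F' : AddMonoidAlgebra ℂ (Fin 2 → ℤ)} {v : Fin 2 → ℤ} {β : ℝ}
    (hlow : ∀ z, wt w z < β → F.coeff z = F'.coeff z) (hvβ : wt w v < β)
    (hv : F.coeff v ≠ 0 ∧ ∀ z, F.coeff z ≠ 0 → z ≠ v → wt w v < wt w z) :
    F'.coeff v ≠ 0 ∧ ∀ z, F'.coeff z ≠ 0 → z ≠ v → wt w v < wt w z := by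
  refine ⟨by rw [← hlow v hvβ]; exact hv.1, fun z hz hne => ?_⟩
  by_cases hzβ : wt w z < β
  · rw [← hlow z hzβ] at hz
    exact hv.2 z hz hne
  · push Not at hzβ
    linarith

/-! ## Low-weight congruence of products of elements with nonnegative-weight support -/

/-- **Product rule for low-weight congruences.** If `F ≡ F'` and `G ≡ G'` below weight `β` and all four
have support of nonnegative weight, then `F G ≡ F' G'` below `β`. [folklore] -/
theorem lowEq_mul {w : Fin 2 → ℝ} {β : ℝ} {F F' G G' : AddMonoidAlgebra ℂ (Fin 2 → ℤ)}
    (hF : ∀ z, F.coeff z ≠ 0 → 0 ≤ wt w z) (hF' : ∀ z, F'.coeff z ≠ 0 → 0 ≤ wt w z)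
    (hG : ∀ z, G.coeff z ≠ 0 → 0 ≤ wt w z) (hG' : ∀ z, G'.coeff z ≠ 0 → 0 ≤ wt w z)
    (hFF : ∀ z, wt w z < β → F.coeff z = F'.coeff z) (hGG : ∀ z, wt w z < β → G.coeff z = G'.coeff z)
    (z : Fin 2 → ℤ) (hz : wt w z < β) : (F * G).coeff z = (F' * G').coeff z := by
  classical
  -- termwise agreement on pairs summing to `z`
  have hterm : ∀ x y, x + y = z → F.coeff x * G.coeff y = F'.coeff x * G'.coeff y := by
    intro x y hxy
    have hw : wt w x + wt w y = wt w z := by rw [← wt_add, hxy]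
    by_cases hx : wt w x < β
    · by_cases hy : wt w y < β
      · rw [hFF x hx, hGG y hy]
      · push Not at hy
        have hxneg : wt w x < 0 := by linarith
        have h1 : F.coeff x = 0 := by by_contra h; exact absurd (hF x h) (not_le.mpr hxneg)
        have h2 : F'.coeff x = 0 := by by_contra h; exact absurd (hF' x h) (not_le.mpr hxneg)
        rw [h1, h2, zero_mul, zero_mul]
    · push Not at hx
      have hyneg : wt w y < 0 := by linarith
      have h1 : G.coeff y = 0 := by by_contra h; exact absurd (hG y h) (not_le.mpr hyneg)
      have h2 : G'.coeff y = 0 := by by_contra h; exact absurd (hG' y h) (not_le.mpr hyneg)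
      rw [h1, h2, mul_zero, mul_zero]
  -- extend both double sums to common index sets
  set SF := F.coeff.support ∪ F'.coeff.support with hSF
  set SG := G.coeff.support ∪ G'.coeff.support with hSG
  have key : ∀ (A B : AddMonoidAlgebra ℂ (Fin 2 → ℤ)), A.coeff.support ⊆ SF → B.coeff.support ⊆ SG →
      (A * B).coeff z = ∑ x ∈ SF, ∑ y ∈ SG, if x + y = z then A.coeff x * B.coeff y else 0 := by
    intro A B hA hB
    rw [coeff_mul_eq_sum]
    rw [Finset.sum_subset hA]
    · refine Finset.sum_congr rfl fun x _ => ?_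
      refine Finset.sum_subset hB fun y _ hy => ?_
      rw [Finsupp.notMem_support_iff.mp hy, mul_zero, ite_self]
    · intro x _ hx
      refine Finset.sum_eq_zero fun y _ => ?_
      rw [Finsupp.notMem_support_iff.mp hx, zero_mul, ite_self]
  rw [key F G Finset.subset_union_left Finset.subset_union_left,
    key F' G' Finset.subset_union_right Finset.subset_union_right]
  refine Finset.sum_congr rfl fun x _ => Finset.sum_congr rfl fun y _ => ?_
  by_cases hxy : x + y = z
  · rw [if_pos hxy, if_pos hxy, hterm x y hxy]
  · rw [if_neg hxy, if_neg hxy]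

/-- Nonnegative-weight support is preserved by products. [folklore] -/
theorem nonneg_mul {w : Fin 2 → ℝ} {F G : AddMonoidAlgebra ℂ (Fin 2 → ℤ)}
    (hF : ∀ z, F.coeff z ≠ 0 → 0 ≤ wt w z) (hG : ∀ z, G.coeff z ≠ 0 → 0 ≤ wt w z) :
    ∀ z, (F * G).coeff z ≠ 0 → 0 ≤ wt w z := by
  intro z hz
  obtain ⟨x, y, hx, hy, rfl⟩ := exists_add_of_coeff_mul_ne_zero hz
  rw [wt_add]
  exact add_nonneg (hF x hx) (hG y hy)

/-- Nonnegative-weight support is preserved by sums. [folklore] -/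
theorem nonneg_add {w : Fin 2 → ℝ} {F G : AddMonoidAlgebra ℂ (Fin 2 → ℤ)}
    (hF : ∀ z, F.coeff z ≠ 0 → 0 ≤ wt w z) (hG : ∀ z, G.coeff z ≠ 0 → 0 ≤ wt w z) :
    ∀ z, (F + G).coeff z ≠ 0 → 0 ≤ wt w z := by
  intro z hz
  simp only [AddMonoidAlgebra.coeff_add, Finsupp.coe_add, Pi.add_apply] at hz
  by_cases h : F.coeff z = 0
  · rw [h, zero_add] at hz; exact hG z hz
  · exact hF z h

/-- Nonnegative-weight support is preserved by finite products. [folklore] -/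
theorem nonneg_prod {w : Fin 2 → ℝ} {ι : Type*} (t : Finset ι) (F : ι → AddMonoidAlgebra ℂ (Fin 2 → ℤ))
    (hF : ∀ i ∈ t, ∀ z, (F i).coeff z ≠ 0 → 0 ≤ wt w z) :
    ∀ z, (∏ i ∈ t, F i).coeff z ≠ 0 → 0 ≤ wt w z := by
  classical
  induction t using Finset.induction_on with
  | empty =>
    intro z hz
    simp only [Finset.prod_empty, AddMonoidAlgebra.one_def, AddMonoidAlgebra.coeff_single] at hz
    have : z = 0 := by
      by_contra h
      exact hz (by simp [Ne.symm h])
    rw [this, wt_zero]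
  | insert a t ha ih =>
    rw [Finset.prod_insert ha]
    exact nonneg_mul (hF a (Finset.mem_insert_self a t))
      (ih fun i hi => hF i (Finset.mem_insert_of_mem hi))

/-- Low-weight congruence is preserved by finite products of nonnegative-weight elements. [folklore] -/
theorem lowEq_prod {w : Fin 2 → ℝ} {β : ℝ} {ι : Type*} (t : Finset ι)
    (F F' : ι → AddMonoidAlgebra ℂ (Fin 2 → ℤ))
    (hF : ∀ i ∈ t, ∀ z, (F i).coeff z ≠ 0 → 0 ≤ wt w z) (hF' : ∀ i ∈ t, ∀ z, (F' i).coeff z ≠ 0 → 0 ≤ wt w z)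
    (hFF : ∀ i ∈ t, ∀ z, wt w z < β → (F i).coeff z = (F' i).coeff z) :
    ∀ z, wt w z < β → (∏ i ∈ t, F i).coeff z = (∏ i ∈ t, F' i).coeff z := by
  classical
  induction t using Finset.induction_on with
  | empty => intro z _; simp
  | insert a t ha ih =>
    rw [Finset.prod_insert ha, Finset.prod_insert ha]
    refine lowEq_mul (hF a (Finset.mem_insert_self a t)) (hF' a (Finset.mem_insert_self a t))
      (nonneg_prod t F fun i hi => hF i (Finset.mem_insert_of_mem hi))
      (nonneg_prod t F' fun i hi => hF' i (Finset.mem_insert_of_mem hi))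
      (hFF a (Finset.mem_insert_self a t))
      (ih (fun i hi => hF i (Finset.mem_insert_of_mem hi)) (fun i hi => hF' i (Finset.mem_insert_of_mem hi))
        (fun i hi => hFF i (Finset.mem_insert_of_mem hi)))

end Summit.ValiantsHypothesis.ValiantsHypothesis.Theorems.NewtonTauWeakFixedK3k16

end
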